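import Literature.NumberTheory.Sieve.MoebiusShiftedPrimesProofsWith
import Literature.NumberTheory.Sieve.LiouvilleSiftedCharSum
import HarnessLib

/-!
# Möbius on shifted primes — Theorem 1.1 of Lichtman 2020 from Lemma 4.5 and Siegel–Walfisz for `μ`

Topic `Literature/NumberTheory/Sieve`.  Everything in this file is PROVED; it has no definitions and
introduces no named fact.  It closes the decomposition of the named facts
`Literature.NumberTheory.Sieve.lichtman2020_moebius_shifted_primes_avg` (Theorem 1.1 of J. D. Lichtman,
*Averages of the Möbius function on shifted primes*, Q. J. Math. 73 (2022) 729–757, arXiv:2009.08969v2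
[Lichtman2020], qualitative part) and `…_avg_power` (power range) down to two classical inputs:

* `Lichtman2020_primeCharacterSum` — Lemma 4.5 of the paper (the Vinogradov–Korobov bound for the
  prime character polynomials `∑_{P ≤ p ≤ Q} χ(p) p^{-1-it}`, `MoebiusShiftedPrimesTypical.lean`), and
* `Literature.NumberTheory.LFunctions.SiegelWalfiszMoebius` — the Siegel–Walfisz theorem for the Möbius
  function in arithmetic progressions (Montgomery–Vaughan, *Multiplicative Number Theory I*, §11.3
  Exercise 13(f); `SiegelWalfiszMoebius.lean`),

every other step of the paper being proved in the tree along the corrected typical sets `S_c`,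
`c ≥ 100` (`MoebiusShiftedPrimesTypical.lean` records the gap in the printed proof of Proposition 5.1
at the printed exponent and the repair): Thm 1.1 ⇐ Thm 2.2_c + (2.5)
(`MoebiusShiftedPrimesProofsWith.lean`, `…DecompositionWith.lean`, `…SieveBound.lean`); Thm 2.2_c ⇐
Prop 2.3_c ⇐ Props 3.1_c (`…MinorArcWith.lean`) + 3.2_c ⇐ Prop 3.4_c (`…ArcsWith.lean`); Prop 3.4_c ⇐
Prop 5.1_c + Lemma 4.8 (`…MeanSquare.lean`, with Lemma 4.6 `…Parseval.lean` and Lemma 4.1);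
Prop 5.1_c ⇐ Lemma 4.5 (`…DirichletMeanValue.lean`, with Lemmas 4.1, 4.3, 4.4, 4.7); Lemma 4.8 ⇐
Siegel–Walfisz for `μ` + the fundamental lemma (`LiouvilleSiftedCharSum.lean`,
`LiouvilleSiftedClasses.lean`, `SiegelWalfiszLiouville.lean`).

* `lichtman2020_moebius_shifted_primes_avg_of_primeCharacterSum_of_siegelWalfiszMoebius`
* `lichtman2020_moebius_shifted_primes_avg_power_of_primeCharacterSum_of_siegelWalfiszMoebius`

## References

* J. D. Lichtman, arXiv:2009.08969v2, Theorem 1.1 and §§2–5 [Lichtman2020].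
* H. L. Montgomery, R. C. Vaughan, *Multiplicative Number Theory I*, §11.3 Ex. 13(f)
  [MontgomeryVaughan2007].
-/

namespace Literature.NumberTheory.Sieve

/-- **Lichtman 2020, Theorem 1.1 (qualitative part), conditional on Lemma 4.5 of the paper and the
Siegel–Walfisz theorem for `μ`**: `log H/log₂ X → ∞` implies
`∑_{h ≤ H} |∑_{p ≤ X} μ(p+h)| = o(Hπ(X))`, given `Lichtman2020_primeCharacterSum` (Vinogradov–Korobov
for prime character sums) and `SiegelWalfiszMoebius`.  Lemma 4.8 is supplied by
`Lichtman2020_liouvilleCharacterSifted_of_siegelWalfiszMoebius`. [cite: Lichtman2020, Theorem 1.1] -/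
theorem lichtman2020_moebius_shifted_primes_avg_of_primeCharacterSum_of_siegelWalfiszMoebius
    (h45 : Lichtman2020_primeCharacterSum)
    (hSW : Literature.NumberTheory.LFunctions.SiegelWalfiszMoebius) :
    lichtman2020_moebius_shifted_primes_avg :=
  lichtman2020_moebius_shifted_primes_avg_of_primeCharacterSum_of_liouvilleCharacterSifted h45
    (Lichtman2020_liouvilleCharacterSifted_of_siegelWalfiszMoebius hSW)

/-- **Lichtman 2020, Theorem 1.1 (power range `H = X^θ`), conditional on Lemma 4.5 of the paper and
the Siegel–Walfisz theorem for `μ`** (through the tree's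
`lichtman2020_moebius_shifted_primes_avg_power_of_primeCharacterSum_of_liouvilleCharacterSifted`,
`MoebiusShiftedPrimesMinorArcWith.lean`). [cite: Lichtman2020, Theorem 1.1] -/
theorem lichtman2020_moebius_shifted_primes_avg_power_of_primeCharacterSum_of_siegelWalfiszMoebius
    (h45 : Lichtman2020_primeCharacterSum)
    (hSW : Literature.NumberTheory.LFunctions.SiegelWalfiszMoebius) :
    lichtman2020_moebius_shifted_primes_avg_power :=
  lichtman2020_moebius_shifted_primes_avg_power_of_primeCharacterSum_of_liouvilleCharacterSifted h45
    (Lichtman2020_liouvilleCharacterSifted_of_siegelWalfiszMoebius hSW)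

end Literature.NumberTheory.Sieve
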